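import Literature.Geometry.Lorentzian.CoordCylinderRicci
import Literature.Geometry.Lorentzian.NonRadiatingBurnettLimit
import HarnessLib

/-!
# Crux `ChannelsResolveTameDevelopmentsR` (stmt-FinalStateConjecture-14075), line
# `trapped-set-observability-analyticity` — stub `stub_trappedSetObservability` (S4):
# flat space is a presented dark exterior (non-vacuity of the hypothesis class of the lever)

Stub S4 of the line asserts `IsPresentedDarkExterior a r₀ G → TwoSidedConcentrationLaw a r₀ G`
for every field of metric components `G` on the presentation cylinder
`cyl a r₀ = {x ∈ E4 | r₀ < r(a, x)}` (`r(a,·)` the Kerr–Schild oblate radius).  This file lands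
the NON-VACUITY of its hypothesis class on the horizonless side: for every `a` and every `r₀ < 0`
the constant components `G := fun _ ↦ η` satisfy EVERY clause of `IsPresentedDarkExterior a r₀ G`,
written here UNFOLDED over the Literature vocabulary (`MetricCoord.{IsMetricOn, sharpAt, chrAt,
ricAt}`, `Kerr.radius`, `Minkowski.bilin`, `E4.{dx, basisVector, spatialNorm}`, `iteratedFDeriv`)
exactly as in the body of the line's definition with the cylinder written as the set
`{x : E4 | r₀ < Kerr.radius a x}` (the line's `Defs` are not in the tree yet), so that the
corollary `IsPresentedDarkExterior a r₀ (fun _ ↦ Minkowski.bilin)` is `Iff.rfl`-close.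

Clause by clause (`§1`): `η` is a smooth symmetric invertible field of components on the (open)
cylinder; `dx⁰(♯_η dx⁰) = η⁻¹(dt, dt) = -1 ≤ -c₀` with `c₀ = 1`; the excision-collar clause is
VACUOUS with `δ := -r₀ > 0`, because `r(a,·) ≥ 0 = r₀ + δ` (`Kerr.radius_nonneg`); `Ric(η) = 0`
and `Γ(η) = 0` (constant components: `MetricCoord.ricAt_const`, `MetricCoord.chrAt_const`), so
the harmonic-gauge sum vanishes termwise; all `C^k` norms are bounded by
`‖η‖ + ‖η⁻¹‖` (`iteratedFDeriv` of a constant vanishes for `k ≥ 1`); `‖G − η‖ = 0`,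
`DG = 0`, `D²G = 0`, `∂₀G = 0`, so the `1/ρ`-symbol and non-radiation clauses hold with `C = 0`
and any `R'`.  `§2` assembles the registered sub-goal `stub_flatIsPresentedDarkExterior`.
-/

set_option linter.dupNamespace false

noncomputable section

namespace Summit.FinalStateConjecture.FinalStateConjecture.Theorems.TrappedSet

open Literature.Geometry.Lorentzian
open scoped Manifold ContDiff Topology ENNReal NNReal
open Filter Set Function TopologicalSpace

/-! ## §1 The clauses of `IsPresentedDarkExterior a r₀ (fun _ ↦ η)` one by one -/

section FlatPresentedExterior

/-- The constant components `η` are a smooth symmetric invertible field of metric components on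
the presentation cylinder `{r₀ < r(a,·)}` (open, as a strict superlevel set of the continuous
oblate radius). [cite: ONeill1983, Ch. 3, Def. 3.1] -/
theorem isMetricOn_const_minkowski_setOf_lt_radius (a r₀ : ℝ) :
    MetricCoord.IsMetricOn (fun _ : E4 ↦ Minkowski.bilin) {x : E4 | r₀ < Kerr.radius a x} where
  isOpen := isOpen_lt continuous_const (Kerr.continuous_radius a)
  contDiffOn := contDiffOn_const
  symm _ _ v w := Minkowski.bilin_symm v w
  isInvertible _ _ := CoordSphere.isInvertible_minkowski

/-- `η⁻¹(dx⁰, dx⁰) = dx⁰(♯_η dx⁰) = dx⁰(-∂₀) = -1`: the slices `{x⁰ = t}` of flat space are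
uniformly spacelike. [folklore] -/
theorem dx_zero_sharpAt_const_minkowski_dx_zero (x : E4) :
    (E4.dx 0) (MetricCoord.sharpAt (fun _ : E4 ↦ Minkowski.bilin) x (E4.dx 0)) = -1 := by
  rw [CoordSphere.sharpAt_minkowski_dx_zero, map_neg]
  simp

/-- **The slicing/collar clause for flat space with `r₀ < 0`**: with `c₀ = 1` the slices are
uniformly spacelike, and with `δ = -r₀ > 0` the excision collar `{r(a,·) < r₀ + δ = 0}` is EMPTY
(`r(a,·) ≥ 0`), so its two inequalities are vacuous. [folklore] -/
theorem collarClause_const_minkowski (a : ℝ) {r₀ : ℝ} (h : r₀ < 0) :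
    ∃ c₀ δ : ℝ, 0 < c₀ ∧ 0 < δ ∧ ∀ x ∈ {x : E4 | r₀ < Kerr.radius a x},
      (E4.dx 0) (MetricCoord.sharpAt (fun _ : E4 ↦ Minkowski.bilin) x (E4.dx 0)) ≤ -c₀ ∧
      (Kerr.radius a x < r₀ + δ →
        (fderiv ℝ (Kerr.radius a) x)
            (MetricCoord.sharpAt (fun _ : E4 ↦ Minkowski.bilin) x (fderiv ℝ (Kerr.radius a) x)) ≤
          -c₀ ∧
        c₀ ≤ (E4.dx 0)
          (MetricCoord.sharpAt (fun _ : E4 ↦ Minkowski.bilin) x (fderiv ℝ (Kerr.radius a) x))) := by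
  refine ⟨1, -r₀, one_pos, neg_pos.mpr h, fun x _ ↦ ⟨?_, fun hx ↦ ?_⟩⟩
  · rw [dx_zero_sharpAt_const_minkowski_dx_zero]
  · exact absurd hx (not_lt.mpr (by simpa using Kerr.radius_nonneg a x))

/-- `Ric(η) = 0` as a bilinear form, at every point. [cite: ONeill1983, Ch. 3, Lemma 3.52] -/
theorem ricAt_const_minkowski (x : E4) :
    MetricCoord.ricAt (fun _ : E4 ↦ Minkowski.bilin) x = 0 := by
  ext Y Z
  exact MetricCoord.ricAt_const Minkowski.bilin x Y Z

/-- **Cartesian coordinates of flat space are harmonic**: the contracted Christoffel sum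
`Σ_β Γ_η(♯_η dx^β, ∂_β) = g^{αβ}Γ_{αβ}` vanishes termwise (`Γ_η = 0`). [cite: ONeill1983, Ch. 3, Prop. 3.13] -/
theorem harmonicGauge_const_minkowski (x : E4) :
    ∑ β : Fin 4, MetricCoord.chrAt (fun _ : E4 ↦ Minkowski.bilin) x
      (MetricCoord.sharpAt (fun _ : E4 ↦ Minkowski.bilin) x (E4.dx β)) (E4.basisVector β) = 0 :=
  Finset.sum_eq_zero fun β _ ↦ by rw [MetricCoord.chrAt_const]; rfl

/-- **Uniform `C^k` bounds**: every `‖D^k η‖` and `‖η⁻¹‖` is bounded on the cylinder by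
`‖η‖ + ‖η⁻¹‖` (`D^k` of a constant vanishes for `k ≥ 1`). [folklore] -/
theorem ckBound_const_minkowski (S : Set E4) (k : ℕ) :
    ∃ C : ℝ, ∀ x ∈ S, ‖iteratedFDeriv ℝ k (fun _ : E4 ↦ Minkowski.bilin) x‖ ≤ C ∧
      ‖MetricCoord.sharpAt (fun _ : E4 ↦ Minkowski.bilin) x‖ ≤ C := by
  refine ⟨‖(Minkowski.bilin : E4 →L[ℝ] E4 →L[ℝ] ℝ)‖ + ‖(Minkowski.bilin : E4 →L[ℝ] E4 →L[ℝ] ℝ).inverse‖,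
    fun x _ ↦ ⟨?_, ?_⟩⟩
  · rcases Nat.eq_zero_or_pos k with rfl | hk
    · rw [norm_iteratedFDeriv_zero]
      exact le_add_of_nonneg_right
        (norm_nonneg ((Minkowski.bilin : E4 →L[ℝ] E4 →L[ℝ] ℝ).inverse))
    · rw [iteratedFDeriv_const_of_ne hk.ne', Pi.zero_apply, norm_zero]
      positivity
  · change ‖(Minkowski.bilin : E4 →L[ℝ] E4 →L[ℝ] ℝ).inverse‖ ≤ _
    exact le_add_of_nonneg_left (norm_nonneg (Minkowski.bilin : E4 →L[ℝ] E4 →L[ℝ] ℝ))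

/-- **`1/ρ` symbols**: `‖η − η‖ ρ = 0`, `‖Dη‖ ρ = 0`, `‖D²η‖ ρ = 0`. [folklore] -/
theorem symbolBound_const_minkowski (S : Set E4) :
    ∃ C : ℝ, ∀ x ∈ S, ‖(fun _ : E4 ↦ Minkowski.bilin) x - Minkowski.bilin‖ * E4.spatialNorm x ≤ C ∧
      ‖iteratedFDeriv ℝ 1 (fun _ : E4 ↦ Minkowski.bilin) x‖ * E4.spatialNorm x ≤ C ∧
      ‖iteratedFDeriv ℝ 2 (fun _ : E4 ↦ Minkowski.bilin) x‖ * E4.spatialNorm x ≤ C := by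
  refine ⟨0, fun x _ ↦ ⟨?_, ?_, ?_⟩⟩
  · have h : (fun _ : E4 ↦ (Minkowski.bilin : E4 →L[ℝ] E4 →L[ℝ] ℝ)) x - Minkowski.bilin = 0 :=
      sub_self (Minkowski.bilin : E4 →L[ℝ] E4 →L[ℝ] ℝ)
    rw [h, ContinuousLinearMap.opNorm_zero, zero_mul]
  · rw [iteratedFDeriv_const_of_ne one_ne_zero, Pi.zero_apply, norm_zero, zero_mul]
  · rw [iteratedFDeriv_const_of_ne two_ne_zero, Pi.zero_apply, norm_zero, zero_mul]

/-- **Two-sided non-radiation**: `∂₀η = 0`, so every `ρ ‖D^m ∂₀η‖` vanishes identically (any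
`R'` works). [folklore] -/
theorem nonRadiation_const_minkowski (S : Set E4) (m : ℕ) (_hm : m ≤ 2) (ε : ℝ) (hε : 0 < ε) :
    ∃ R' : ℝ, ∀ x ∈ S, R' < E4.spatialNorm x →
      ‖iteratedFDeriv ℝ m
          (fun y ↦ fderiv ℝ (fun _ : E4 ↦ (Minkowski.bilin : E4 →L[ℝ] E4 →L[ℝ] ℝ)) y
            (E4.basisVector 0)) x‖ * E4.spatialNorm x ≤ ε := by
  refine ⟨0, fun x _ _ ↦ ?_⟩
  have h0 : (fun y : E4 ↦ fderiv ℝ (fun _ : E4 ↦ (Minkowski.bilin : E4 →L[ℝ] E4 →L[ℝ] ℝ)) y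
      (E4.basisVector 0)) = fun _ ↦ 0 := by
    funext y
    rw [fderiv_const_apply]
    rfl
  rw [h0, iteratedFDeriv_fun_zero, Pi.zero_apply, norm_zero, zero_mul]
  exact hε.le

end FlatPresentedExterior

/-! ## §2 The registered sub-goal: flat space is a presented dark exterior for `r₀ < 0` -/

/-- Registered sub-goal `stub_flatIsPresentedDarkExterior` of `stub_trappedSetObservability` (S4):
**for every `a` and every `r₀ < 0` the constant components `η` on the cylinder
`{r₀ < r(a,·)} (= E4)` satisfy every clause of the line's `IsPresentedDarkExterior a r₀ (fun _ ↦ η)`**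
— smooth symmetric invertible; slices uniformly spacelike (`c₀ = 1`) with an EMPTY excision
collar (`δ = -r₀`); Ricci-flat; harmonic; uniformly `C^k`-bounded with bounded inverse;
`1/ρ`-asymptotically Minkowskian with constant `0`; non-radiating.  Stated with the definition
unfolded (the conjunction is its body verbatim for `G := fun _ ↦ Minkowski.bilin`), so the
horizonless half of the hypothesis class of the two-sided concentration law is inhabited.
[folklore] -/
theorem stub_flatIsPresentedDarkExterior :
    ∀ (a r₀ : ℝ), r₀ < 0 → MetricCoord.IsMetricOn (fun _ : E4 ↦ Minkowski.bilin) {x : E4 | r₀ < Kerr.radius a x} ∧ (∃ c₀ δ : ℝ, 0 < c₀ ∧ 0 < δ ∧ ∀ x ∈ {x : E4 | r₀ < Kerr.radius a x}, (E4.dx 0) (MetricCoord.sharpAt (fun _ : E4 ↦ Minkowski.bilin) x (E4.dx 0)) ≤ -c₀ ∧ (Kerr.radius a x < r₀ + δ → (fderiv ℝ (Kerr.radius a) x) (MetricCoord.sharpAt (fun _ : E4 ↦ Minkowski.bilin) x (fderiv ℝ (Kerr.radius a) x)) ≤ -c₀ ∧ c₀ ≤ (E4.dx 0) (MetricCoord.sharpAt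 (fun _ : E4 ↦ Minkowski.bilin) x (fderiv ℝ (Kerr.radius a) x)))) ∧ (∀ x ∈ {x : E4 | r₀ < Kerr.radius a x}, MetricCoord.ricAt (fun _ : E4 ↦ Minkowski.bilin) x = 0) ∧ (∀ x ∈ {x : E4 | r₀ < Kerr.radius a x}, ∑ β : Fin 4, MetricCoord.chrAt (fun _ : E4 ↦ Minkowski.bilin) x (MetricCoord.sharpAt (fun _ : E4 ↦ Minkowski.bilin) x (E4.dx β)) (E4.basisVector β) = 0) ∧ (∀ k : ℕ, ∃ C : ℝ, ∀ x ∈ {x : E4 | r₀ < Kerr.radius a x}, ‖iteratedFDeriv ℝ k (fun _ : E4 ↦ (Minkowski.bilin : E4 →L[ℝ] E4 →L[ℝ] ℝ)) x‖ ≤ C ∧ ‖MetricCoord.sharpAt (fun _ : E4 ↦ Minkowski.bilin) x‖ ≤ C) ∧ (∃ C : ℝ, ∀ x ∈ {x : E4 | r₀ < Kerr.radius a x}, ‖(fun _ : E4 ↦ (Minkowski.bilin : E4 →L[ℝ] E4 →L[ℝ] ℝ)) x - Minkowski.bilin‖ * E4.spatialNorm x ≤ C ∧ ‖iteratedFDeriv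 ℝ 1 (fun _ : E4 ↦ (Minkowski.bilin : E4 →L[ℝ] E4 →L[ℝ] ℝ)) x‖ * E4.spatialNorm x ≤ C ∧ ‖iteratedFDeriv ℝ 2 (fun _ : E4 ↦ (Minkowski.bilin : E4 →L[ℝ] E4 →L[ℝ] ℝ)) x‖ * E4.spatialNorm x ≤ C) ∧ (∀ m : ℕ, m ≤ 2 → ∀ ε : ℝ, 0 < ε → ∃ R' : ℝ, ∀ x ∈ {x : E4 | r₀ < Kerr.radius a x}, R' < E4.spatialNorm x → ‖iteratedFDeriv ℝ m (fun y ↦ fderiv ℝ (fun _ : E4 ↦ (Minkowski.bilin : E4 →L[ℝ] E4 →L[ℝ] ℝ)) y (E4.basisVector 0)) x‖ * E4.spatialNorm x ≤ ε) :=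
  fun a _ h ↦ ⟨isMetricOn_const_minkowski_setOf_lt_radius a _, collarClause_const_minkowski a h,
    fun x _ ↦ ricAt_const_minkowski x, fun x _ ↦ harmonicGauge_const_minkowski x,
    ckBound_const_minkowski _, symbolBound_const_minkowski _,
    fun m hm ε hε ↦ nonRadiation_const_minkowski _ m hm ε hε⟩

end Summit.FinalStateConjecture.FinalStateConjecture.Theorems.TrappedSet

end
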